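import Summits.BirchSwinnertonDyer.BirchSwinnertonDyer.Theorems.ErratumRoadFiveEulerHalfNotRamExhaustion
import Summits.BirchSwinnertonDyer.BirchSwinnertonDyer.Theorems.ErratumRoadFiveEulerHalfNotRamLevelLoweringCut
import Summits.BirchSwinnertonDyer.BirchSwinnertonDyer.Theses.ErratumRoadFive
import Literature.NumberTheory.EllipticCurves.QuadraticTwistLocalDataAtTwoHoldsProofs
import HarnessLib

/-!
# Route `ErratumRoadFive` (K2, `p ≥ 5`), crux `EulerHalfNotRamNoInertSetAtFive` (item stmt-BirchSwinnertonDyer-19715), line `birth`: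
# THE v11 RESIDUAL — the v10 residual stub («three offending carriers ≡ 1 (mod p)») FOLLOWS from its restriction to the ALL-CARRIERS locus OFF the
# genus-zero additive conductors, given the route items, the saved inert display (HOLE 1) and two printed level-lowering facts
# (cell `bsd-stepL`, lead seat `bsd-line-er5-p1` g1; `--supports stmt-BirchSwinnertonDyer-19715 --as helper`)

WHAT. Consumers over the ROUTE ITEMS of `Theses/ErratumRoadFive.lean` (binders `h₅ : PublishedInputsFive` destructured as in the line of record,
`h₃ : X11aLowerHalf`, `hJL : ShimuraParametrizationDataNonempty`, `hCO : PastenComponentOrdersInput`; Barrios' `c₂` fact is the tree theorem `…_holds`) of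
the two helper files `ErratumRoadFiveEulerHalfNotRamExhaustion` ((B♯) road + exhaustion) and `ErratumRoadFiveEulerHalfNotRamLevelLoweringCut` (the cuts):

* §1 `res_upToOneSharpAtFive_of_items` — the (B♯) road over the items (+ HOLE 1).
* §2 `res_genusZeroAdditiveAtFive_of_items` — 19715's statement (binders VERBATIM) PLUS «a second multiplicative prime» PLUS «additive conductor of `E` is
  `1, 4, 8, 16, 9` or `25`» is a THEOREM modulo items + HOLE 1 + the two printed facts: ¬(A) and ¬(B♯) would make every multiplicative prime a
  `p`-carrier (exhaustion), in particular `p ∣ ord_p Δ_min`, which the level-lowering cut forbids on these conductors; so (B♯) holds and its road applies.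
  Corollaries: `res_semistableAtFive_of_items` (19715 + `Semistable W`), `res_semistable_le_seven_vacuous` (`p ≤ 7`: hypotheses contradictory).
* §3 `res_threeOneModOffendingAtFive_of_afterCuts_of_items` — the REGISTERED v10 residual (`stub_res_otherMultThreeOneModOffendingAtFive`, -w2 g1: three
  offending split carriers `≡ 1 (mod p)`, statement VERBATIM as the conclusion) from the v11 residual = v10's + «every multiplicative prime, `p` included, is
  a `p`-carrier» + «the additive conductor is none of `1, 4, 8, 16, 9, 25`» (displayed as the hypothesis `hRes`, exactly the v11 stub
  `stub_res_otherMultAllCarriersOffGenusZeroAtFive`).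

HONEST FRAMING: THEOREMS ONLY, CONDITIONAL on their displayed hypotheses (route items by name, the typed saved display, the printed named facts
`diamond1995_refinedSerre` and Ogg–Saito `artinConductorExponent_tate_eq_conductorExponent_of_isElliptic`); no `sorry`, no definition, no new named fact;
nothing booked; item 19715 is NOT closed; BSD is proved for no curve; no summit statement is touched. Census: the residual had 0 pairs below `5·10⁵` before
and after; the gain is every conductor beyond the census (the residual provably lives on curves whose `E[p]` is congruent to a weight-2 newform of level
`N(ρ̄) ∣ N_add` of positive genus). Credit: the cut is bsd-idea-9 g3's idea `level-lowering-cut` (crux workfile `Lines/level_lowering_cut.lean`).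
[cite: Ribet1990, Thm. 1.1] [cite: Diamond1995RefinedSerre, Thm. 1.1] [cite: Jetchev2008, Cor. 1.5] [cite: PastenShimura2024, §6.6, Lemma 6.18]
-/

set_option autoImplicit false
set_option linter.dupNamespace false

noncomputable section

open scoped Classical

open WeierstrassCurve Literature.NumberTheory.EllipticCurves Literature.NumberTheory.EllipticCurves.BarriosEtAl2025
  Literature.NumberTheory.EllipticCurves.ModularForms Literature.NumberTheory.EllipticCurves.Rank1Residual
  Literature.NumberTheory.EllipticCurves.Rank1Residual.Typed Literature.NumberTheory.Automorphic
  Summit.BirchSwinnertonDyer.Rank1Residual Summit.BirchSwinnertonDyer.Rank1Residual.X11b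

namespace Summit.BirchSwinnertonDyer.BirchSwinnertonDyer.Theorems.EulerHalfResidualCuts

/-! ### §1 The (B♯) road over the route items -/

/-- **(B♯) over the ROUTE ITEMS.** Every X11b ∧ `p ≥ 5` ∧ surj ∧ ¬(ram) pair with a sharp up-to-one datum has `Typed.MissingUpperBoundAt W p`, GIVEN
`PublishedInputsFive` (GZK, modularity, newform, Friedberg–Hoffstein inert twist, Mazur's Manin constant), `X11aLowerHalf`, `ShimuraParametrizationDataNonempty`,
`PastenComponentOrdersInput`, Barrios' `c₂` THEOREM, and the saved inert display at offending carriers (HOLE 1, the line's typed stub in ∀-form).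
[cite: Jetchev2008, Cor. 1.5] [cite: PastenShimura2024, §6.6] -/
theorem res_upToOneSharpAtFive_of_items
    (h₅ : Summit.BirchSwinnertonDyer.BirchSwinnertonDyer.Theses.ErratumRoadFive.PublishedInputsFive)
    (h₃ : Summit.BirchSwinnertonDyer.BirchSwinnertonDyer.Theses.ErratumRoadFive.X11aLowerHalf)
    (hJL : Summit.BirchSwinnertonDyer.BirchSwinnertonDyer.Theses.ErratumRoadFive.ShimuraParametrizationDataNonempty)
    (hCO : Summit.BirchSwinnertonDyer.BirchSwinnertonDyer.Theses.ErratumRoadFive.PastenComponentOrdersInput)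
    (hSav : ∀ (W : WeierstrassCurve ℚ) [W.IsElliptic] [W.IsGloballyMinimal] (p : ℕ) [Fact p.Prime]
      (q₁ : ℕ) [Fact q₁.Prime], ClassX11b W p → 5 ≤ p → Surj W p → ¬ Ram W p →
      W.HasSplitMultiplicativeReductionAtPrime q₁ → p ∣ padicValInt q₁ W.minimalDiscriminantInt →
      Theorems.ShimuraInertSavedDisplayAtD W p q₁) :
    ∀ (W : WeierstrassCurve ℚ) [W.IsElliptic] [W.IsGloballyMinimal] (p : ℕ) [Fact p.Prime],
      ClassX11b W p → 5 ≤ p → Surj W p → ¬ Ram W p →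
      (∃ (q₁ : ℕ) (_ : Fact q₁.Prime) (S : Finset ℕ), W.HasSplitMultiplicativeReductionAtPrime q₁ ∧
        p ∣ padicValInt q₁ W.minimalDiscriminantInt ∧
        (∀ ℓ ∈ S, ∃ _ : Fact ℓ.Prime, Mult W ℓ) ∧ Even S.card ∧ p ∈ S ∧ q₁ ∉ S ∧
        (∀ (ℓ : ℕ) [Fact ℓ.Prime], ℓ ∉ S → ℓ ≠ q₁ → W.HasSplitMultiplicativeReductionAtPrime ℓ →
          ¬ p ∣ padicValInt ℓ W.minimalDiscriminantInt) ∧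
        ((∃ (ℓ₁ : ℕ) (_ : Fact ℓ₁.Prime), Mult W ℓ₁ ∧ ¬ p ∣ padicValInt ℓ₁ W.minimalDiscriminantInt ∧
            (ℓ₁ ∈ S ∨ ∃ (t : ℕ) (_ : Fact t.Prime), Mult W t ∧ t ∉ S ∧ t ≠ ℓ₁)) ∨
          ∃ R ⊆ S, S.card = 2 * R.card ∧ ∀ q ∈ R, q ≠ 2 ∧ ¬ p ∣ q - 1)) →
      Typed.MissingUpperBoundAt W p := by
  obtain ⟨-, -, -, -, -, hGZK, hmod, hnf, -, -, hMaz, -, hFH, -, -⟩ := h₅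
  exact EulerHalfExhaustion.res_upToOneSharpAtFive_of_savedDisplayD_of_lowerX11a hGZK hmod hnf hFH hMaz
    localTamagawaNumber_quadraticTwist_two_mem_of_goodReduction_holds hJL hCO (fun Wd _ _ p _ hXa ↦ h₃ Wd p hXa) hSav

/-! ### §2 19715 on the genus-zero additive conductors (and on semistable curves) -/

/-- **19715 with a second multiplicative prime, ON THE GENUS-ZERO ADDITIVE CONDUCTORS, over the ROUTE ITEMS** (+ HOLE 1 + the printed level-lowering facts
`diamond1995_refinedSerre`, Ogg–Saito by name): the crux's binders VERBATIM (X11b, `p ≥ 5`, surj, ¬(ram), `p ∣ ∏ c`, NO inert-set datum) + «a multiplicative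
`ℓ ≠ p`» + «for some `r ∈ {2,3,5}` every prime `≠ r` is semistable and `r^(k_r+1) ∤ N_E`» ⟹ `Typed.MissingUpperBoundAt W p`. Proof: were there no (B♯)
datum, every multiplicative prime would be a `p`-carrier (exhaustion), in particular `p ∣ ord_p Δ_min`, contradicting the level-lowering cut; so (B♯) holds
and §1 applies. CONDITIONAL; nothing booked; 19715 NOT closed. [cite: Ribet1990, Thm. 1.1] [cite: Diamond1995RefinedSerre, Thm. 1.1] -/
theorem res_genusZeroAdditiveAtFive_of_items
    (h₅ : Summit.BirchSwinnertonDyer.BirchSwinnertonDyer.Theses.ErratumRoadFive.PublishedInputsFive)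
    (h₃ : Summit.BirchSwinnertonDyer.BirchSwinnertonDyer.Theses.ErratumRoadFive.X11aLowerHalf)
    (hJL : Summit.BirchSwinnertonDyer.BirchSwinnertonDyer.Theses.ErratumRoadFive.ShimuraParametrizationDataNonempty)
    (hCO : Summit.BirchSwinnertonDyer.BirchSwinnertonDyer.Theses.ErratumRoadFive.PastenComponentOrdersInput)
    (hLL : diamond1995_refinedSerre)
    (hOS : ∀ (W : WeierstrassCurve ℚ) (ℓ : ℕ) [Fact ℓ.Prime],
      W.artinConductorExponent_tate_eq_conductorExponent_of_isElliptic ℓ)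
    (hSav : ∀ (W : WeierstrassCurve ℚ) [W.IsElliptic] [W.IsGloballyMinimal] (p : ℕ) [Fact p.Prime]
      (q₁ : ℕ) [Fact q₁.Prime], ClassX11b W p → 5 ≤ p → Surj W p → ¬ Ram W p →
      W.HasSplitMultiplicativeReductionAtPrime q₁ → p ∣ padicValInt q₁ W.minimalDiscriminantInt →
      Theorems.ShimuraInertSavedDisplayAtD W p q₁) :
    ∀ (W : WeierstrassCurve ℚ) [W.IsElliptic] [W.IsGloballyMinimal] (p : ℕ) [Fact p.Prime],
      Summit.BirchSwinnertonDyer.Rank1Residual.ClassX11b W p → 5 ≤ p →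
      Literature.NumberTheory.EllipticCurves.Rank1Residual.Surj W p →
      ¬ Literature.NumberTheory.EllipticCurves.Rank1Residual.Ram W p → p ∣ W.tamagawaProduct →
      (∃ ℓ : ℕ, ∃ _ : Fact ℓ.Prime, ℓ ≠ p ∧ W.HasMultiplicativeReductionAtPrime ℓ) →
      ¬ (∃ S : Finset ℕ, (∀ ℓ ∈ S, ∃ _ : Fact ℓ.Prime, Literature.NumberTheory.EllipticCurves.Rank1Residual.Mult W ℓ) ∧
          Even S.card ∧ p ∈ S ∧
          (∀ (ℓ : ℕ) [Fact ℓ.Prime], ℓ ∉ S → W.HasSplitMultiplicativeReductionAtPrime ℓ →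
            ¬ p ∣ padicValInt ℓ W.minimalDiscriminantInt) ∧
          (¬ p ∣ padicValInt p W.minimalDiscriminantInt ∨
            ∃ R ⊆ S, S.card = 2 * R.card ∧ ∀ q ∈ R, q ≠ 2 ∧ ¬ p ∣ q - 1)) →
      (((∀ (ℓ : ℕ) [Fact ℓ.Prime], ℓ ≠ 2 → W.HasGoodReductionAtPrime ℓ ∨ W.HasMultiplicativeReductionAtPrime ℓ) ∧
            ¬ 2 ^ 5 ∣ W.conductorNorm ℤ) ∨
        ((∀ (ℓ : ℕ) [Fact ℓ.Prime], ℓ ≠ 3 → W.HasGoodReductionAtPrime ℓ ∨ W.HasMultiplicativeReductionAtPrime ℓ) ∧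
            ¬ 3 ^ 3 ∣ W.conductorNorm ℤ) ∨
        ((∀ (ℓ : ℕ) [Fact ℓ.Prime], ℓ ≠ 5 → W.HasGoodReductionAtPrime ℓ ∨ W.HasMultiplicativeReductionAtPrime ℓ) ∧
            ¬ 5 ^ 3 ∣ W.conductorNorm ℤ)) →
      Literature.NumberTheory.EllipticCurves.Rank1Residual.Typed.MissingUpperBoundAt W p := by
  intro W _ _ p _ hX hp5 hsurj hnram _ hother hnoA hlocus
  obtain ⟨-, -, hMp, hirr⟩ := id hX
  have hnf : exists_isNewformOf := h₅.2.2.2.2.2.2.2.1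
  by_cases hB : ∃ (q₁ : ℕ) (_ : Fact q₁.Prime) (S : Finset ℕ), W.HasSplitMultiplicativeReductionAtPrime q₁ ∧
      p ∣ padicValInt q₁ W.minimalDiscriminantInt ∧
      (∀ ℓ ∈ S, ∃ _ : Fact ℓ.Prime, Mult W ℓ) ∧ Even S.card ∧ p ∈ S ∧ q₁ ∉ S ∧
      (∀ (ℓ : ℕ) [Fact ℓ.Prime], ℓ ∉ S → ℓ ≠ q₁ → W.HasSplitMultiplicativeReductionAtPrime ℓ →
        ¬ p ∣ padicValInt ℓ W.minimalDiscriminantInt) ∧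
      ((∃ (ℓ₁ : ℕ) (_ : Fact ℓ₁.Prime), Mult W ℓ₁ ∧ ¬ p ∣ padicValInt ℓ₁ W.minimalDiscriminantInt ∧
          (ℓ₁ ∈ S ∨ ∃ (t : ℕ) (_ : Fact t.Prime), Mult W t ∧ t ∉ S ∧ t ≠ ℓ₁)) ∨
        ∃ R ⊆ S, S.card = 2 * R.card ∧ ∀ q ∈ R, q ≠ 2 ∧ ¬ p ∣ q - 1)
  · exact res_upToOneSharpAtFive_of_items h₅ h₃ hJL hCO hSav W p hX hp5 hsurj hnram hB
  · exact absurd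
      (EulerHalfExhaustion.dvd_ordp_of_not_inertSetDatum_of_not_upToOneSharpDatum W p hp5 hMp hother hnoA hB)
      (EulerHalfLevelLoweringCut.not_dvd_ordp_of_genusZeroAdditive_of_not_ram hnf hLL hOS W p hp5 hMp hirr hnram hlocus)

/-- **19715 ON SEMISTABLE CURVES, over the ROUTE ITEMS** (+ HOLE 1 + `diamond1995_refinedSerre`; Ogg–Saito NOT needed): the crux's binders VERBATIM +
`Semistable W` ⟹ `Typed.MissingUpperBoundAt W p`. The second multiplicative prime comes for free on the Tamagawa locus (S1b ∩ semistable = ∅).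
CONDITIONAL; nothing booked; 19715 NOT closed. [cite: Ribet1990, Thm. 1.1] [cite: Diamond1995RefinedSerre, Thm. 1.1] -/
theorem res_semistableAtFive_of_items
    (h₅ : Summit.BirchSwinnertonDyer.BirchSwinnertonDyer.Theses.ErratumRoadFive.PublishedInputsFive)
    (h₃ : Summit.BirchSwinnertonDyer.BirchSwinnertonDyer.Theses.ErratumRoadFive.X11aLowerHalf)
    (hJL : Summit.BirchSwinnertonDyer.BirchSwinnertonDyer.Theses.ErratumRoadFive.ShimuraParametrizationDataNonempty)
    (hCO : Summit.BirchSwinnertonDyer.BirchSwinnertonDyer.Theses.ErratumRoadFive.PastenComponentOrdersInput)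
    (hLL : diamond1995_refinedSerre)
    (hSav : ∀ (W : WeierstrassCurve ℚ) [W.IsElliptic] [W.IsGloballyMinimal] (p : ℕ) [Fact p.Prime]
      (q₁ : ℕ) [Fact q₁.Prime], ClassX11b W p → 5 ≤ p → Surj W p → ¬ Ram W p →
      W.HasSplitMultiplicativeReductionAtPrime q₁ → p ∣ padicValInt q₁ W.minimalDiscriminantInt →
      Theorems.ShimuraInertSavedDisplayAtD W p q₁) :
    ∀ (W : WeierstrassCurve ℚ) [W.IsElliptic] [W.IsGloballyMinimal] (p : ℕ) [Fact p.Prime],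
      Summit.BirchSwinnertonDyer.Rank1Residual.ClassX11b W p → 5 ≤ p →
      Literature.NumberTheory.EllipticCurves.Rank1Residual.Surj W p →
      ¬ Literature.NumberTheory.EllipticCurves.Rank1Residual.Ram W p → p ∣ W.tamagawaProduct →
      ¬ (∃ S : Finset ℕ, (∀ ℓ ∈ S, ∃ _ : Fact ℓ.Prime, Literature.NumberTheory.EllipticCurves.Rank1Residual.Mult W ℓ) ∧
          Even S.card ∧ p ∈ S ∧
          (∀ (ℓ : ℕ) [Fact ℓ.Prime], ℓ ∉ S → W.HasSplitMultiplicativeReductionAtPrime ℓ →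
            ¬ p ∣ padicValInt ℓ W.minimalDiscriminantInt) ∧
          (¬ p ∣ padicValInt p W.minimalDiscriminantInt ∨
            ∃ R ⊆ S, S.card = 2 * R.card ∧ ∀ q ∈ R, q ≠ 2 ∧ ¬ p ∣ q - 1)) →
      Semistable W →
      Literature.NumberTheory.EllipticCurves.Rank1Residual.Typed.MissingUpperBoundAt W p := by
  intro W _ _ p _ hX hp5 hsurj hnram htam hnoA hsst
  obtain ⟨-, -, hMp, hirr⟩ := id hX
  have hnf : exists_isNewformOf := h₅.2.2.2.2.2.2.2.1
  have hother := EulerHalfLevelLoweringCut.exists_otherMult_of_semistable_of_dvd_tamagawaProduct hnf hLL W p hp5 hMp hirr hsst hnram htam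
  by_cases hB : ∃ (q₁ : ℕ) (_ : Fact q₁.Prime) (S : Finset ℕ), W.HasSplitMultiplicativeReductionAtPrime q₁ ∧
      p ∣ padicValInt q₁ W.minimalDiscriminantInt ∧
      (∀ ℓ ∈ S, ∃ _ : Fact ℓ.Prime, Mult W ℓ) ∧ Even S.card ∧ p ∈ S ∧ q₁ ∉ S ∧
      (∀ (ℓ : ℕ) [Fact ℓ.Prime], ℓ ∉ S → ℓ ≠ q₁ → W.HasSplitMultiplicativeReductionAtPrime ℓ →
        ¬ p ∣ padicValInt ℓ W.minimalDiscriminantInt) ∧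
      ((∃ (ℓ₁ : ℕ) (_ : Fact ℓ₁.Prime), Mult W ℓ₁ ∧ ¬ p ∣ padicValInt ℓ₁ W.minimalDiscriminantInt ∧
          (ℓ₁ ∈ S ∨ ∃ (t : ℕ) (_ : Fact t.Prime), Mult W t ∧ t ∉ S ∧ t ≠ ℓ₁)) ∨
        ∃ R ⊆ S, S.card = 2 * R.card ∧ ∀ q ∈ R, q ≠ 2 ∧ ¬ p ∣ q - 1)
  · exact res_upToOneSharpAtFive_of_items h₅ h₃ hJL hCO hSav W p hX hp5 hsurj hnram hB
  · exact absurd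
      (EulerHalfExhaustion.dvd_ordp_of_not_inertSetDatum_of_not_upToOneSharpDatum W p hp5 hMp hother hnoA hB)
      (EulerHalfLevelLoweringCut.not_dvd_ordp_of_semistable_of_not_ram hnf hLL W p hp5 hMp hirr hsst hnram)

/-- **At `p ≤ 7` the semistable ¬(ram) locus is EMPTY** (a semistable X11b pair at `p ∈ {5,7}` has a (ram) prime), so 19715 is vacuous there — no saved
display needed. Modularity is read from `PublishedInputsFive`. [cite: Serre1987, §2.8 Prop. 4] [cite: Ribet1990, Thm. 1.1] -/
theorem res_semistable_le_seven_vacuous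
    (h₅ : Summit.BirchSwinnertonDyer.BirchSwinnertonDyer.Theses.ErratumRoadFive.PublishedInputsFive) (hLL : diamond1995_refinedSerre)
    (W : WeierstrassCurve ℚ) [W.IsElliptic] [W.IsGloballyMinimal] (p : ℕ) [Fact p.Prime]
    (hX : ClassX11b W p) (hp5 : 5 ≤ p) (hp7 : p ≤ 7) (hnram : ¬ Ram W p) (hsst : Semistable W) :
    Typed.MissingUpperBoundAt W p :=
  (hnram (EulerHalfLevelLoweringCut.ram_of_semistable_of_le_seven h₅.2.2.2.2.2.2.2.1 hLL W p hp5 hp7 hX.2.2.2 hsst)).elim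

/-! ### §3 The registered v10 residual from the v11 residual (all carriers, off the genus-zero additive conductors) -/

/-- **THE v11 RESIDUAL REDUCTION, over the ROUTE ITEMS** (+ HOLE 1 `hSav`, in v10 the DERIVED saved display, + the printed `diamond1995_refinedSerre` and Ogg–Saito by
name). Conclusion = the REGISTERED v10 residual `stub_res_otherMultThreeOneModOffendingAtFive` VERBATIM (three offending split carriers `≡ 1 (mod p)`, no inert₂ ∕
split-set ∕ up-to-one₂ datum — halves read with `2` allowed). Hypothesis `hRes` = the v11 residual: the v10 binders VERBATIM followed by «every multiplicative prime
(so `p` itself) is a `p`-carrier» and «the additive conductor of `E` is none of `1, 4, 8, 16, 9, 25`» (three negated locus clauses). Proof: a SHARP up-to-one datum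
(B♯, strict half) is served by §1; an inert-set datum with the strict half would be an inert₂ datum; otherwise exhaustion gives the all-carriers clause, the
genus-zero conductors are then excluded by the level-lowering cut (they force `p ∤ ord_p Δ_min`), and `hRes` takes the rest. Bookkeeping; nothing booked;
19715 NOT closed; BSD NOT proved. [cite: PastenShimura2024, §6.6] [cite: Ribet1990, Thm. 1.1] [cite: Diamond1995RefinedSerre, Thm. 1.1] -/
theorem res_threeOneModOffendingAtFive_of_afterCuts_of_items
    (h₅ : Summit.BirchSwinnertonDyer.BirchSwinnertonDyer.Theses.ErratumRoadFive.PublishedInputsFive)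
    (h₃ : Summit.BirchSwinnertonDyer.BirchSwinnertonDyer.Theses.ErratumRoadFive.X11aLowerHalf)
    (hJL : Summit.BirchSwinnertonDyer.BirchSwinnertonDyer.Theses.ErratumRoadFive.ShimuraParametrizationDataNonempty)
    (hCO : Summit.BirchSwinnertonDyer.BirchSwinnertonDyer.Theses.ErratumRoadFive.PastenComponentOrdersInput)
    (hLL : diamond1995_refinedSerre)
    (hOS : ∀ (W : WeierstrassCurve ℚ) (ℓ : ℕ) [Fact ℓ.Prime],
      W.artinConductorExponent_tate_eq_conductorExponent_of_isElliptic ℓ)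
    (hSav : ∀ (W : WeierstrassCurve ℚ) [W.IsElliptic] [W.IsGloballyMinimal] (p : ℕ) [Fact p.Prime]
      (q₁ : ℕ) [Fact q₁.Prime], ClassX11b W p → 5 ≤ p → Surj W p → ¬ Ram W p →
      W.HasSplitMultiplicativeReductionAtPrime q₁ → p ∣ padicValInt q₁ W.minimalDiscriminantInt →
      Theorems.ShimuraInertSavedDisplayAtD W p q₁)
    (hRes : ∀ (W : WeierstrassCurve ℚ) [W.IsElliptic] [W.IsGloballyMinimal] (p : ℕ) [Fact p.Prime], Summit.BirchSwinnertonDyer.Rank1Residual.ClassX11b W p → 5 ≤ p → Literature.NumberTheory.EllipticCurves.Rank1Residual.Surj W p → ¬ Literature.NumberTheory.EllipticCurves.Rank1Residual.Ram W p → p ∣ W.tamagawaProduct → (∃ ℓ : ℕ, ∃ _ : Fact ℓ.Prime, ℓ ≠ p ∧ W.HasMultiplicativeReductionAtPrime ℓ) →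
      (∃ (q₁ q₂ q₃ : ℕ) (_ : Fact q₁.Prime) (_ : Fact q₂.Prime) (_ : Fact q₃.Prime),
        q₁ ≠ p ∧ q₂ ≠ p ∧ q₃ ≠ p ∧ q₁ ≠ q₂ ∧ q₁ ≠ q₃ ∧ q₂ ≠ q₃ ∧
        (W.HasSplitMultiplicativeReductionAtPrime q₁ ∧ p ∣ padicValInt q₁ W.minimalDiscriminantInt ∧ p ∣ q₁ - 1) ∧
        (W.HasSplitMultiplicativeReductionAtPrime q₂ ∧ p ∣ padicValInt q₂ W.minimalDiscriminantInt ∧ p ∣ q₂ - 1) ∧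
        (W.HasSplitMultiplicativeReductionAtPrime q₃ ∧ p ∣ padicValInt q₃ W.minimalDiscriminantInt ∧ p ∣ q₃ - 1)) →
      ¬ (∃ S : Finset ℕ, (∀ ℓ ∈ S, ∃ _ : Fact ℓ.Prime, Literature.NumberTheory.EllipticCurves.Rank1Residual.Mult W ℓ) ∧ Even S.card ∧ p ∈ S ∧ (∀ (ℓ : ℕ) [Fact ℓ.Prime], ℓ ∉ S → W.HasSplitMultiplicativeReductionAtPrime ℓ → ¬ p ∣ padicValInt ℓ W.minimalDiscriminantInt) ∧ (¬ p ∣ padicValInt p W.minimalDiscriminantInt ∨ ∃ R ⊆ S, S.card = 2 * R.card ∧ ∀ q ∈ R, ¬ p ∣ q - 1)) → ¬ (∃ S : Finset ℕ, (∀ ℓ ∈ S, ∃ _ : Fact ℓ.Prime, Literature.NumberTheory.EllipticCurves.Rank1Residual.Mult W ℓ) ∧ Even S.card ∧ p ∉ S ∧ (∀ (ℓ : ℕ) [Fact ℓ.Prime], ℓ ∉ S → W.HasSplitMultiplicativeReductionAtPrime ℓ → ¬ p ∣ padicValInt ℓ W.minimalDiscriminantInt) ∧ ((∃ (ℓ₀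 : ℕ) (_ : Fact ℓ₀.Prime), Literature.NumberTheory.EllipticCurves.Rank1Residual.Mult W ℓ₀ ∧ ℓ₀ ≠ p ∧ ¬ p ∣ padicValInt ℓ₀ W.minimalDiscriminantInt) ∨ ∃ R ⊆ S, S.card = 2 * R.card ∧ ∀ q ∈ R, ¬ p ∣ q - 1)) →
      ¬ (∃ (q₁ : ℕ) (_ : Fact q₁.Prime) (S : Finset ℕ), W.HasSplitMultiplicativeReductionAtPrime q₁ ∧
        p ∣ padicValInt q₁ W.minimalDiscriminantInt ∧
        (∀ ℓ ∈ S, ∃ _ : Fact ℓ.Prime, Literature.NumberTheory.EllipticCurves.Rank1Residual.Mult W ℓ) ∧ Even S.card ∧ p ∈ S ∧ q₁ ∉ S ∧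
        (∀ (ℓ : ℕ) [Fact ℓ.Prime], ℓ ∉ S → ℓ ≠ q₁ → W.HasSplitMultiplicativeReductionAtPrime ℓ →
          ¬ p ∣ padicValInt ℓ W.minimalDiscriminantInt) ∧
        ∃ R ⊆ S, S.card = 2 * R.card ∧ ∀ q ∈ R, ¬ p ∣ q - 1) →
      (∀ (ℓ : ℕ) [Fact ℓ.Prime], Literature.NumberTheory.EllipticCurves.Rank1Residual.Mult W ℓ → p ∣ padicValInt ℓ W.minimalDiscriminantInt) →
      ¬ ((∀ (ℓ : ℕ) [Fact ℓ.Prime], ℓ ≠ 2 → W.HasGoodReductionAtPrime ℓ ∨ W.HasMultiplicativeReductionAtPrime ℓ) ∧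
          ¬ 2 ^ 5 ∣ W.conductorNorm ℤ) →
      ¬ ((∀ (ℓ : ℕ) [Fact ℓ.Prime], ℓ ≠ 3 → W.HasGoodReductionAtPrime ℓ ∨ W.HasMultiplicativeReductionAtPrime ℓ) ∧
          ¬ 3 ^ 3 ∣ W.conductorNorm ℤ) →
      ¬ ((∀ (ℓ : ℕ) [Fact ℓ.Prime], ℓ ≠ 5 → W.HasGoodReductionAtPrime ℓ ∨ W.HasMultiplicativeReductionAtPrime ℓ) ∧
          ¬ 5 ^ 3 ∣ W.conductorNorm ℤ) →
      Literature.NumberTheory.EllipticCurves.Rank1Residual.Typed.MissingUpperBoundAt W p) :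
    ∀ (W : WeierstrassCurve ℚ) [W.IsElliptic] [W.IsGloballyMinimal] (p : ℕ) [Fact p.Prime], Summit.BirchSwinnertonDyer.Rank1Residual.ClassX11b W p → 5 ≤ p → Literature.NumberTheory.EllipticCurves.Rank1Residual.Surj W p → ¬ Literature.NumberTheory.EllipticCurves.Rank1Residual.Ram W p → p ∣ W.tamagawaProduct → (∃ ℓ : ℕ, ∃ _ : Fact ℓ.Prime, ℓ ≠ p ∧ W.HasMultiplicativeReductionAtPrime ℓ) →
      (∃ (q₁ q₂ q₃ : ℕ) (_ : Fact q₁.Prime) (_ : Fact q₂.Prime) (_ : Fact q₃.Prime),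
        q₁ ≠ p ∧ q₂ ≠ p ∧ q₃ ≠ p ∧ q₁ ≠ q₂ ∧ q₁ ≠ q₃ ∧ q₂ ≠ q₃ ∧
        (W.HasSplitMultiplicativeReductionAtPrime q₁ ∧ p ∣ padicValInt q₁ W.minimalDiscriminantInt ∧ p ∣ q₁ - 1) ∧
        (W.HasSplitMultiplicativeReductionAtPrime q₂ ∧ p ∣ padicValInt q₂ W.minimalDiscriminantInt ∧ p ∣ q₂ - 1) ∧
        (W.HasSplitMultiplicativeReductionAtPrime q₃ ∧ p ∣ padicValInt q₃ W.minimalDiscriminantInt ∧ p ∣ q₃ - 1)) →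
      ¬ (∃ S : Finset ℕ, (∀ ℓ ∈ S, ∃ _ : Fact ℓ.Prime, Literature.NumberTheory.EllipticCurves.Rank1Residual.Mult W ℓ) ∧ Even S.card ∧ p ∈ S ∧ (∀ (ℓ : ℕ) [Fact ℓ.Prime], ℓ ∉ S → W.HasSplitMultiplicativeReductionAtPrime ℓ → ¬ p ∣ padicValInt ℓ W.minimalDiscriminantInt) ∧ (¬ p ∣ padicValInt p W.minimalDiscriminantInt ∨ ∃ R ⊆ S, S.card = 2 * R.card ∧ ∀ q ∈ R, ¬ p ∣ q - 1)) → ¬ (∃ S : Finset ℕ, (∀ ℓ ∈ S, ∃ _ : Fact ℓ.Prime, Literature.NumberTheory.EllipticCurves.Rank1Residual.Mult W ℓ) ∧ Even S.card ∧ p ∉ S ∧ (∀ (ℓ : ℕ) [Fact ℓ.Prime], ℓ ∉ S → W.HasSplitMultiplicativeReductionAtPrime ℓ → ¬ p ∣ padicValInt ℓ W.minimalDiscriminantInt) ∧ ((∃ (ℓ₀ : ℕ) (_ : Fact ℓ₀.Prime), Literature.NumberTheory.EllipticCurves.Rank1Residual.Mult W ℓ₀ ∧ ℓ₀ ≠ p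 ∧ ¬ p ∣ padicValInt ℓ₀ W.minimalDiscriminantInt) ∨ ∃ R ⊆ S, S.card = 2 * R.card ∧ ∀ q ∈ R, ¬ p ∣ q - 1)) →
      ¬ (∃ (q₁ : ℕ) (_ : Fact q₁.Prime) (S : Finset ℕ), W.HasSplitMultiplicativeReductionAtPrime q₁ ∧
        p ∣ padicValInt q₁ W.minimalDiscriminantInt ∧
        (∀ ℓ ∈ S, ∃ _ : Fact ℓ.Prime, Literature.NumberTheory.EllipticCurves.Rank1Residual.Mult W ℓ) ∧ Even S.card ∧ p ∈ S ∧ q₁ ∉ S ∧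
        (∀ (ℓ : ℕ) [Fact ℓ.Prime], ℓ ∉ S → ℓ ≠ q₁ → W.HasSplitMultiplicativeReductionAtPrime ℓ →
          ¬ p ∣ padicValInt ℓ W.minimalDiscriminantInt) ∧
        ∃ R ⊆ S, S.card = 2 * R.card ∧ ∀ q ∈ R, ¬ p ∣ q - 1) →
      Literature.NumberTheory.EllipticCurves.Rank1Residual.Typed.MissingUpperBoundAt W p := by
  intro W _ _ p _ hX hp5 hsurj hnram htam hother h3 hnoA₂ hnoD hnoB₂
  obtain ⟨-, -, hMp, hirr⟩ := id hX
  have hnf : exists_isNewformOf := h₅.2.2.2.2.2.2.2.1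
  by_cases hB : ∃ (q₁ : ℕ) (_ : Fact q₁.Prime) (S : Finset ℕ), W.HasSplitMultiplicativeReductionAtPrime q₁ ∧
      p ∣ padicValInt q₁ W.minimalDiscriminantInt ∧
      (∀ ℓ ∈ S, ∃ _ : Fact ℓ.Prime, Mult W ℓ) ∧ Even S.card ∧ p ∈ S ∧ q₁ ∉ S ∧
      (∀ (ℓ : ℕ) [Fact ℓ.Prime], ℓ ∉ S → ℓ ≠ q₁ → W.HasSplitMultiplicativeReductionAtPrime ℓ →
        ¬ p ∣ padicValInt ℓ W.minimalDiscriminantInt) ∧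
      ((∃ (ℓ₁ : ℕ) (_ : Fact ℓ₁.Prime), Mult W ℓ₁ ∧ ¬ p ∣ padicValInt ℓ₁ W.minimalDiscriminantInt ∧
          (ℓ₁ ∈ S ∨ ∃ (t : ℕ) (_ : Fact t.Prime), Mult W t ∧ t ∉ S ∧ t ≠ ℓ₁)) ∨
        ∃ R ⊆ S, S.card = 2 * R.card ∧ ∀ q ∈ R, q ≠ 2 ∧ ¬ p ∣ q - 1)
  · exact res_upToOneSharpAtFive_of_items h₅ h₃ hJL hCO hSav W p hX hp5 hsurj hnram hB
  -- an inert-set datum with the STRICT half (`q ≠ 2 ∧ p ∤ q − 1`) would be an inert₂ datum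
  have hnoA : ¬ ∃ S : Finset ℕ, (∀ ℓ ∈ S, ∃ _ : Fact ℓ.Prime, Mult W ℓ) ∧ Even S.card ∧ p ∈ S ∧
      (∀ (ℓ : ℕ) [Fact ℓ.Prime], ℓ ∉ S → W.HasSplitMultiplicativeReductionAtPrime ℓ → ¬ p ∣ padicValInt ℓ W.minimalDiscriminantInt) ∧
      (¬ p ∣ padicValInt p W.minimalDiscriminantInt ∨ ∃ R ⊆ S, S.card = 2 * R.card ∧ ∀ q ∈ R, q ≠ 2 ∧ ¬ p ∣ q - 1) := by
    rintro ⟨S, hSm, hSe, hpS, hFC, hdeg⟩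
    refine hnoA₂ ⟨S, hSm, hSe, hpS, hFC, ?_⟩
    rcases hdeg with hW | ⟨R, hRS, hcard, hR⟩
    · exact Or.inl hW
    · exact Or.inr ⟨R, hRS, hcard, fun q hq ↦ (hR q hq).2⟩
  -- no (B♯) datum: every multiplicative prime is a `p`-carrier (exhaustion), in particular `p ∣ ord_p Δ_min`
  have hAC := EulerHalfExhaustion.allCarriers_of_not_inertSetDatum_of_not_upToOneSharpDatum W p hp5 hMp hother hnoA hB
  -- … which the level-lowering cut forbids on the genus-zero additive conductors
  have h2 : ¬ ((∀ (ℓ : ℕ) [Fact ℓ.Prime], ℓ ≠ 2 → W.HasGoodReductionAtPrime ℓ ∨ W.HasMultiplicativeReductionAtPrime ℓ) ∧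
      ¬ 2 ^ 5 ∣ W.conductorNorm ℤ) := fun h ↦
    EulerHalfLevelLoweringCut.not_dvd_ordp_of_twoPowerAdditive_of_not_ram hnf hLL hOS W p hp5 hMp hirr hnram h.1 h.2 (hAC p hMp)
  have h3' : ¬ ((∀ (ℓ : ℕ) [Fact ℓ.Prime], ℓ ≠ 3 → W.HasGoodReductionAtPrime ℓ ∨ W.HasMultiplicativeReductionAtPrime ℓ) ∧
      ¬ 3 ^ 3 ∣ W.conductorNorm ℤ) := fun h ↦
    EulerHalfLevelLoweringCut.not_dvd_ordp_of_threeSquareAdditive_of_not_ram hnf hLL hOS W p hp5 hMp hirr hnram h.1 h.2 (hAC p hMp)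
  have h5' : ¬ ((∀ (ℓ : ℕ) [Fact ℓ.Prime], ℓ ≠ 5 → W.HasGoodReductionAtPrime ℓ ∨ W.HasMultiplicativeReductionAtPrime ℓ) ∧
      ¬ 5 ^ 3 ∣ W.conductorNorm ℤ) := fun h ↦
    EulerHalfLevelLoweringCut.not_dvd_ordp_of_locusFive_of_not_ram hnf hLL hOS W p hp5 hMp hirr hnram h.1 h.2 (hAC p hMp)
  exact hRes W p hX hp5 hsurj hnram htam hother h3 hnoA₂ hnoD hnoB₂ hAC h2 h3' h5'

end Summit.BirchSwinnertonDyer.BirchSwinnertonDyer.Theorems.EulerHalfResidualCuts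

end
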